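import Summits.Ventures.PercRepro.RankLevelSetIndepCD
import Summits.Ventures.PercRepro.RankLevelSetBiIndepLRPaving

/-! # RankLevelSetIndepCDPaving — EVERY PAVING MATROID SATISFIES (CD) (night-1 g27; dossier §39.9)

For a PAVING matroid (`Paving M`: every subset of the ground set with fewer elements than the rank is independent)
the contraction/deletion profiles `x_k = #{T ⊆ E ∖ {e} : #T = k, T ∪ {e} independent}` and
`y_k = #{T ⊆ E ∖ {e} : #T = k, T independent}` are full binomial rows below the rank: if `x_{k+1} ≠ 0` then
`k + 2 ≤ rank`, so every `k`-subset `T` of `E ∖ {e}` has `T ∪ {e}` independent (`#(T ∪ {e}) = k + 1 < rank`) and every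
`(k+1)`-subset is independent, i.e. `x_k = C(n−1, k)` and `y_{k+1} = C(n−1, k+1)`; with the trivial bounds
`x_{k+1} ≤ C(n−1, k+1)`, `y_k ≤ C(n−1, k)` valid in every finite matroid, `x_{k+1} · y_k ≤ x_k · y_{k+1}`.
**`indepCD_of_paving : Paving M → IndepCD M`** — the first explicit class in the (CD)-class of `RankLevelSetIndepCD`
(uniform matroids included). Every declaration has a docstring; imports: the cell's own modules and Mathlib only.
Axioms: standard. -/

namespace PercRepro

open Set Matroid

variable {α : Type} (M : Matroid α) [M.Finite]

/-- **The trivial bound on the contraction profile**: `x_m ≤ C(#E − 1, m)` in every finite matroid. -/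
lemma contractCount_le_choose {e : α} (he : e ∈ M.E) (m : ℕ) :
    contractCount M e m ≤ (M.E.ncard - 1).choose m := by
  have hE' : (M.E \ {e}).Finite := M.ground_finite.subset Set.sdiff_subset
  rw [← ncard_ground_sdiff_singleton M he, ← ncard_subsets_of_finite hE' m]
  unfold contractCount
  exact Set.ncard_le_ncard (fun T hT => ⟨hT.1, hT.2.1⟩) (hE'.finite_subsets.subset (fun Y hY => hY.1))

/-- **The trivial bound on the deletion profile**: `y_m ≤ C(#E − 1, m)` in every finite matroid. -/
lemma deleteCount_le_choose {e : α} (he : e ∈ M.E) (m : ℕ) :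
    deleteCount M e m ≤ (M.E.ncard - 1).choose m := by
  have hE' : (M.E \ {e}).Finite := M.ground_finite.subset Set.sdiff_subset
  rw [← ncard_ground_sdiff_singleton M he, ← ncard_subsets_of_finite hE' m]
  unfold deleteCount
  exact Set.ncard_le_ncard (fun T hT => ⟨hT.1, hT.2.1⟩) (hE'.finite_subsets.subset (fun Y hY => hY.1))

/-- **The full row of the contraction profile in a paving matroid**: if `m + 1 < rank` then every `m`-subset `T` of
`E ∖ {e}` has `T ∪ {e}` independent, so `x_m = C(#E − 1, m)`. -/
lemma contractCount_eq_choose_of_paving (h : Paving M) {e : α} (he : e ∈ M.E) {m : ℕ}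
    (hm : ((m + 1 : ℕ) : ℕ∞) < M.eRank) : contractCount M e m = (M.E.ncard - 1).choose m := by
  have hE' : (M.E \ {e}).Finite := M.ground_finite.subset Set.sdiff_subset
  rw [← ncard_ground_sdiff_singleton M he, ← ncard_subsets_of_finite hE' m]
  unfold contractCount
  congr 1
  ext T
  simp only [Set.mem_setOf_eq]
  constructor
  · rintro ⟨hTE, hT, -⟩; exact ⟨hTE, hT⟩
  · rintro ⟨hTE, hT⟩
    refine ⟨hTE, hT, ?_⟩
    have heT : e ∉ T := fun hmem => (hTE hmem).2 rfl
    have hTfin : T.Finite := hE'.subset hTE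
    refine paving_indep_of_encard_lt M h (Set.insert_subset he (hTE.trans Set.sdiff_subset)) ?_
    rw [← Set.Finite.cast_ncard_eq (hTfin.insert e), Set.ncard_insert_of_notMem heT hTfin, hT]
    exact hm

/-- **The full row of the deletion profile in a paving matroid**: if `m < rank` then every `m`-subset of `E ∖ {e}` is
independent, so `y_m = C(#E − 1, m)`. -/
lemma deleteCount_eq_choose_of_paving (h : Paving M) {e : α} (he : e ∈ M.E) {m : ℕ}
    (hm : ((m : ℕ) : ℕ∞) < M.eRank) : deleteCount M e m = (M.E.ncard - 1).choose m := by
  have hE' : (M.E \ {e}).Finite := M.ground_finite.subset Set.sdiff_subset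
  rw [← ncard_ground_sdiff_singleton M he, ← ncard_subsets_of_finite hE' m]
  unfold deleteCount
  congr 1
  ext T
  simp only [Set.mem_setOf_eq]
  constructor
  · rintro ⟨hTE, hT, -⟩; exact ⟨hTE, hT⟩
  · rintro ⟨hTE, hT⟩
    refine ⟨hTE, hT, ?_⟩
    have hTfin : T.Finite := hE'.subset hTE
    refine paving_indep_of_encard_lt M h (hTE.trans Set.sdiff_subset) ?_
    rw [← Set.Finite.cast_ncard_eq hTfin, hT]
    exact hm

/-- A set `T ⊆ E ∖ {e}` of size `m` with `T ∪ {e}` independent gives `m + 1 ≤ rank`. -/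
lemma succ_le_eRank_of_contract {e : α} {m : ℕ} {T : Set α} (hTE : T ⊆ M.E \ {e}) (hT : T.ncard = m)
    (hind : M.Indep (insert e T)) : ((m + 1 : ℕ) : ℕ∞) ≤ M.eRank := by
  have heT : e ∉ T := fun hmem => (hTE hmem).2 rfl
  have hTfin : T.Finite := M.ground_finite.subset (hTE.trans Set.sdiff_subset)
  have hcard : (insert e T).ncard = m + 1 := by rw [Set.ncard_insert_of_notMem heT hTfin, hT]
  rw [← hcard, Set.Finite.cast_ncard_eq (hTfin.insert e)]
  exact hind.encard_le_eRank

/-- **EVERY PAVING MATROID SATISFIES (CD)**: `Paving M → IndepCD M`. If `x_{k+1} = 0` there is nothing to prove;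
otherwise `k + 2 ≤ rank`, so `x_k` and `y_{k+1}` are full binomial rows and the trivial bounds on `x_{k+1}`, `y_k` give
`x_{k+1} · y_k ≤ C(n−1, k+1) · C(n−1, k) = x_k · y_{k+1}`. -/
theorem indepCD_of_paving (h : Paving M) : IndepCD M := by
  intro e he k
  by_cases hx : contractCount M e (k + 1) = 0
  · rw [hx, zero_mul]; exact Nat.zero_le _
  obtain ⟨T₁, hT₁⟩ := Set.nonempty_of_ncard_ne_zero hx
  have hk2 : ((k + 2 : ℕ) : ℕ∞) ≤ M.eRank := succ_le_eRank_of_contract M hT₁.1 hT₁.2.1 hT₁.2.2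
  have hk1 : ((k + 1 : ℕ) : ℕ∞) < M.eRank := by
    have : ((k + 1 : ℕ) : ℕ∞) < ((k + 2 : ℕ) : ℕ∞) := by exact_mod_cast (by omega : k + 1 < k + 2)
    exact lt_of_lt_of_le this hk2
  calc contractCount M e (k + 1) * deleteCount M e k
      ≤ (M.E.ncard - 1).choose (k + 1) * (M.E.ncard - 1).choose k :=
        Nat.mul_le_mul (contractCount_le_choose M he (k + 1)) (deleteCount_le_choose M he k)
    _ = (M.E.ncard - 1).choose k * (M.E.ncard - 1).choose (k + 1) := mul_comm _ _
    _ = contractCount M e k * deleteCount M e (k + 1) := by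
        rw [contractCount_eq_choose_of_paving M h he hk1, deleteCount_eq_choose_of_paving M h he hk1]

end PercRepro
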